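import Literature.Geometry.DiscreteGeometry.KissingNumberFour
import Literature.Geometry.DiscreteGeometry.KissingCertDefs
import Literature.Geometry.DiscreteGeometry.KissingCertExpandF
import Literature.Geometry.DiscreteGeometry.KissingCertExpandR
import Literature.Geometry.DiscreteGeometry.KissingCertExpandR2
import Literature.Geometry.DiscreteGeometry.KissingCertExpandS
import Literature.Geometry.DiscreteGeometry.KissingCertExpandVT

/-!
# `k(4) = 24`: discharge of `musin2008_kissing_four`

**Musin 2008, Main Theorem (upper bound): `k(4) ≤ 24`.** We prove the vendored fact
`musin2008_kissing_four` — every finite set of unit vectors of `ℝ⁴` with pairwise inner products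
`≤ 1/2` has at most `24` elements — by the semidefinite-programming (three-point) bound of
Bachoc–Vallentin (J. AMS 2008, Theorem 4.2), which for `n = 4`, `d = N = 7` gives `k(4) ≤ 24.58`
(BV §5: "For the kissing number problem in dimension 4 it is d = N = 7"); our feasible
certificate gives `k(4) ≤ 24.7819 < 25`. Musin's own argument (Delsarte extension `f₄`, Lemma B)
is not formalised; the statement proved is his Main Theorem.

Ingredients: `GegenbauerFourPSD` (Schoenberg on `S³`), `LegendreThreePSD` (Schoenberg on `S²`),
`ThreePointKernelP` + `ThreePointBound` (BV's `Y_k` and Theorem 4.2), `PolyCert` +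
`KissingCertComp` (kernel checker) + `KissingCertDefs` (its soundness), `KissingCertDataA/B/C`
(data), `KissingCertExpandF/R/R2/S/VT` (kernel validation of the expansions); below, the
certificate is assembled (as local notation for the explicit records, so that the validated
statements apply verbatim), the remaining cheap checks are run, and the theorem is concluded.

## References
* O. R. Musin, *The kissing number in four dimensions*, Ann. of Math. 168 (2008) 1–32, Main Theorem. [`Musin2008`]
* C. Bachoc, F. Vallentin, *New upper bounds for kissing numbers from semidefinite programming*,
  J. Amer. Math. Soc. 21 (2008) 909–924, Theorem 4.2, §5. [`BachocVallentin2007`]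
-/

namespace Literature.Geometry.DiscreteGeometry

open PolyCert PolyCert.SPoly KissingFourCert

/-- The certificate record (scales `S = 60`, `S' = 50`, `S'' = 50`; `a_k`, `b_ij`, `F` blocks, slacks). -/
local notation "cert𝔠" =>
  (Cert.mk 60 50 50 certA 11975409645093167108 (-509001618563241856) 21636588309856240 [FBlk.mk 0 certFws0, FBlk.mk 1 certFws1, FBlk.mk 2 certFws2, FBlk.mk 3 certFws3, FBlk.mk 4 certFws4, FBlk.mk 5 certFws5, FBlk.mk 6 certFws6, FBlk.mk 7 certFws7] 945701667839702703538176 24491060254654107190558720)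

/-- The claimed polynomial expansions (`F`; Gram forms `r, r_u, r_v, r_t, r_4, q, q_1`). -/
local notation "cert𝔭" =>
  (CertPolys.mk (ofFlat certFPf0 ++ ofFlat certFPf1 ++ ofFlat certFPf2) (ofFlat certRrf0 ++ ofFlat certRrf1 ++ ofFlat certRrf2 ++ ofFlat certRrf3 ++ ofFlat certRrf4 ++ ofFlat certRrf5) (ofFlat certRuPf0 ++ ofFlat certRuPf1 ++ ofFlat certRuPf2 ++ ofFlat certRuPf3) (permBAC (ofFlat certRuPf0 ++ ofFlat certRuPf1 ++ ofFlat certRuPf2 ++ ofFlat certRuPf3)) (permCBA (ofFlat certRuPf0 ++ ofFlat certRuPf1 ++ ofFlat certRuPf2 ++ ofFlat certRuPf3)) (ofFlat certR4Pf0 ++ ofFlat certR4Pf1 ++ ofFlat certR4Pf2) (ofFlat certQqPf0) (ofFlat certQq1Pf0))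

/-- All expansion data are valid. [folklore] -/
theorem certP_ok :
    PolysOK cert𝔠 cert𝔭 (GramBlk.mk certRZ certRL) (GramBlk.mk certRuZ certRuL) (GramBlk.mk certRvZ certRuL)
      (GramBlk.mk certRtZ certRuL) (GramBlk.mk certR4Z certR4L) (GramBlk.mk certQZ certQL) (GramBlk.mk certQ1Z certQ1L) where
  hF := fexpValid_of_chunks _ _ _ _ certFn1 certFn2 certP_F1 certP_F2 certP_F3
  hr := quadOK3_of_chunks _ _ _ _ certRc1 certRc2 (by decide) certP_r1 certP_r2 certP_r3
  hu := quadOK3_of_single _ _ certP_u1 certP_u2 certP_u3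
  hv := quadOK3_of_single _ _ certP_v1 certP_v2 certP_v3
  ht := quadOK3_of_single _ _ certP_t1 certP_t2 certP_t3
  h4 := quadOK3_of_single _ _ certP_41 certP_42 certP_43
  hq := quadOK3_of_single _ _ certP_q1 certP_q2 certP_q3
  hq1 := quadOK3_of_single _ _ certP_q11 certP_q12 certP_q13

set_option maxHeartbeats 0 in
/-- The side conditions of the certificate hold. [folklore] -/
theorem cert_checkSide : checkSide cert𝔠 = true := by decide +kernel

set_option maxHeartbeats 0 in
/-- The numerical bound of the certificate is `< 25` (and `≥ 0`). [folklore] -/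
theorem cert_checkBound : checkBound cert𝔠 cert𝔭 = true := by decide +kernel

set_option maxHeartbeats 0 in
/-- The certificate passes the check of constraint `(i')`. [cite: BachocVallentin2007, Theorem 4.2] -/
theorem cert_checkI : checkI cert𝔠 cert𝔭 = true := by decide +kernel

set_option maxHeartbeats 0 in
/-- The certificate passes the check of constraint `(ii')`. [cite: BachocVallentin2007, Theorem 4.2] -/
theorem cert_checkII : checkII cert𝔠 cert𝔭 = true := by decide +kernel

/-- **Musin's theorem `k(4) ≤ 24`** (discharge of `musin2008_kissing_four`), via the
Bachoc–Vallentin three-point bound `k(4) ≤ 24.7819`. [cite: Musin2008, §2 Main Theorem (k(4) = 24)] -/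
theorem musin2008_kissing_four_holds : musin2008_kissing_four :=
  fun C hC hcode => card_le_24_of_cert cert𝔠 cert𝔭 certP_ok cert_checkI cert_checkII cert_checkSide
    cert_checkBound C hC hcode

end Literature.Geometry.DiscreteGeometry
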